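import Summits.CriticalPhenomena.PercolationContinuityZ3.Theorems.PercNearOneGluingNoHeavyLowerTailAntitheticTransfer
import Literature.Probability.Percolation.ConditionalPositiveAssociationProofs
import Literature.Probability.Percolation.TwoClusterConditionalAssociation
import HarnessLib

/-!
# `NoHeavyLowerTail` (stmt-CriticalPhenomena-4575) — THEOREM IC: the INDEPENDENT-COPIES version of CONJECTURE BIC
# holds on every finite graph, for every avoidance set `R`, for all edge probabilities (prim-hp-2 gen 47)

Support file (`--supports stmt-CriticalPhenomena-4575`, hull-port prover `prim-hp-2`, gen 47; THEOREM-IndepCopies.md).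
Setting: bond percolation with pair probabilities `w e ∈ [0,1)` on a finite vertex type (product weights
`BHK2006.weight`, configurations `Set (Sym2 V)`; `w e = 0` off the intended graph), `C = BHK2006.rC univ s` the open
EDGE cluster of `s`, `R ⊆ V` with `s ∉ R`.  Two INDEPENDENT configurations `ω₁, ω₂` are coupled by the
bicluster-avoidance kernel of CONJECTURE BIC (MEMO-gen31 §1): `π(ω₁,ω₂) = w(ω₁) w(ω₂) 1[no r ∈ R is joined to s in both]`
(`IndepCopies.pw`).  Results, all from `Antithetic.Transfer` (the abstract alternating-transfer lemma) with
van den Berg–Häggström–Kahn 2006 Thm 1.3/1.1 (`BHK2006.core`, PROVED in the tree) supplying the fibre positive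
association and the monotonicity of the transfer operator `T F(ω₂) = E[F(C₁) | C₁ avoids R ∩ W(ω₂)]`:
* `IndepCopies.indep_bic_nonneg` — THEOREM IC: `0 ≤ Σ_{ω₁,ω₂} π(ω₁,ω₂) (F(C₁) − F(C₂))(G(C₁) − G(C₂))` for all
  monotone `F, G` ("same ≥ cross": the ρ = 0 member of the family whose ρ = −1 member is CONJECTURE BIC);
* `IndepCopies.marginal_pa` — the one-copy marginal `ν(ω) = w(ω)·P(C′ avoids R ∩ W(ω))` is positively associated
  on increasing cluster functions;  `IndepCopies.cross_le` — the two copies are negatively correlated.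
No p = ½ and no complement symmetry is used.  File-local definitions `hit`, `hitC`, `pw`, `UpC`; no named facts,
no sorries.
[cite: VandenbergHaggstromKahn2005, Thm. 1.3 (p. 6), Thm. 1.1 (pp. 3–5)]
-/

noncomputable section

namespace Summit.CriticalPhenomena.PercolationContinuityZ3.Theorems
open scoped Classical
open Finset
namespace Antithetic
namespace IndepCopies

open Literature.Probability.Percolation Literature.Probability.Percolation.BHK2006 DecisionTree
open Literature.Probability.LatticeModels (prodBernoulli)
open MeasureTheory

variable {V : Type*} [Fintype V]

/-- The vertices of `R` reached from `s` in the configuration `ω` (the avoidance set that copy `ω` imposes on the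
other copy). [folklore] -/
def hit (R : Set V) (s : V) (ω : Set (Sym2 V)) : Set V :=
  {r | r ∈ R ∧ (openGraph (ω ∩ edgesIn (Finset.univ : Finset V))).Reachable s r}

/-- The same set read off the open edge cluster: the vertices of `R` covered by an edge of `c`. [folklore] -/
def hitC (R : Set V) (c : Set (Sym2 V)) : Set V := {r | r ∈ R ∧ ∃ e ∈ c, r ∈ e}

/-- The pair weight of two INDEPENDENT configurations coupled by bicluster avoidance on `R`:
`w(ω₁) w(ω₂) · 1[no r ∈ R is reached from s in both]`. [folklore] -/
def pw (w : Sym2 V → ℝ) (R : Set V) (s : V) (ω₁ ω₂ : Set (Sym2 V)) : ℝ :=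
  weight w ω₁ * weight w ω₂ * ind (rD Finset.univ s (hit R s ω₂)) ω₁

/-- The class of "increasing cluster functions": `u = F ∘ C_s` on the support, `F` monotone. [folklore] -/
def UpC (w : Sym2 V → ℝ) (R : Set V) (s : V) (u : Set (Sym2 V) → ℝ) : Prop :=
  ∃ F : Set (Sym2 V) → ℝ, Monotone F ∧ ∀ ω, Transfer.marg (pw w R s) ω ≠ 0 → u ω = F (rC Finset.univ s ω)

section Facts

variable {w : Sym2 V → ℝ} {R : Set V} {s : V}

/-- `hit R s ω ⊆ R`. [folklore] -/
theorem hit_subset (R : Set V) (s : V) (ω : Set (Sym2 V)) : hit R s ω ⊆ R := fun _ h => h.1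

omit [Fintype V] in
/-- `hitC R` is monotone in the edge set. [folklore] -/
theorem hitC_mono (R : Set V) : Monotone (hitC (V := V) R) :=
  fun _ _ h _ ⟨hr, e, he, hre⟩ => ⟨hr, e, h he, hre⟩

/-- `hit` is a function of the open edge cluster (for `s ∉ R`). [folklore] -/
theorem hit_eq_hitC (hs : s ∉ R) (ω : Set (Sym2 V)) : hit R s ω = hitC R (rC Finset.univ s ω) := by
  ext r
  simp only [hit, hitC, Set.mem_setOf_eq]
  constructor
  · rintro ⟨hr, h⟩
    rcases (reachable_iff_exists_mem_openEdgeCluster _ s r).1 h with h' | h'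
    · exact absurd (h' ▸ hr) hs
    · exact ⟨hr, h'⟩
  · rintro ⟨hr, h⟩
    exact ⟨hr, (reachable_iff_exists_mem_openEdgeCluster _ s r).2 (Or.inr h)⟩

/-- Compatibility is symmetric: `ω₁` avoids what `ω₂` reaches in `R` iff `ω₂` avoids what `ω₁` reaches.
[folklore] -/
theorem mem_rD_hit_comm (ω₁ ω₂ : Set (Sym2 V)) :
    ω₁ ∈ rD Finset.univ s (hit R s ω₂) ↔ ω₂ ∈ rD Finset.univ s (hit R s ω₁) := by
  simp only [rD, hit, Set.mem_setOf_eq]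
  constructor
  · intro h r ⟨hr, h2⟩ h1; exact h r ⟨hr, h1⟩ h2
  · intro h r ⟨hr, h2⟩ h1; exact h r ⟨hr, h1⟩ h2

/-- The pair weight is symmetric. [folklore] -/
theorem pw_symm (ω₁ ω₂ : Set (Sym2 V)) : pw w R s ω₁ ω₂ = pw w R s ω₂ ω₁ := by
  unfold pw
  by_cases h : ω₁ ∈ rD Finset.univ s (hit R s ω₂)
  · rw [ind_of_mem h, ind_of_mem ((mem_rD_hit_comm ω₁ ω₂).1 h)]; ring
  · rw [ind_of_not_mem h, ind_of_not_mem (fun h' => h ((mem_rD_hit_comm ω₁ ω₂).2 h'))]; ring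

/-- The pair weight is nonnegative. [folklore] -/
theorem pw_nonneg (hw0 : ∀ e, 0 ≤ w e) (hw1 : ∀ e, w e ≤ 1) (ω₁ ω₂ : Set (Sym2 V)) :
    0 ≤ pw w R s ω₁ ω₂ :=
  mul_nonneg (mul_nonneg (weight_nonneg hw0 hw1 _) (weight_nonneg hw0 hw1 _)) (ind_nonneg _ _)

/-- The marginal: `ν(ω) = w(ω) · P(C avoids hit(ω))`. [folklore] -/
theorem marg_eq (ω : Set (Sym2 V)) :
    Transfer.marg (pw w R s) ω = weight w ω * ∑ x, weight w x * ind (rD Finset.univ s (hit R s ω)) x := by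
  unfold Transfer.marg pw; rw [Finset.mul_sum]; exact Finset.sum_congr rfl fun x _ => by ring

/-- A positive pair weight forces a non-null state. [folklore] -/
theorem marg_ne_zero_of_pw (hw0 : ∀ e, 0 ≤ w e) (hw1 : ∀ e, w e ≤ 1) {x y : Set (Sym2 V)}
    (h : pw w R s x y ≠ 0) : Transfer.marg (pw w R s) x ≠ 0 := by
  have hle : pw w R s y x ≤ Transfer.marg (pw w R s) x :=
    Finset.single_le_sum (f := fun y => pw w R s y x) (fun y _ => pw_nonneg hw0 hw1 y x) (Finset.mem_univ y)
  rw [pw_symm] at hle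
  intro h0; rw [h0] at hle
  exact h (le_antisymm hle (pw_nonneg hw0 hw1 x y))

/-- Fibre sums only see the values of `u` on the support. [folklore] -/
theorem fib_congr (hw0 : ∀ e, 0 ≤ w e) (hw1 : ∀ e, w e ≤ 1) {u g : Set (Sym2 V) → ℝ}
    (hug : ∀ x, Transfer.marg (pw w R s) x ≠ 0 → u x = g x) (y : Set (Sym2 V)) :
    Transfer.fib (pw w R s) u y = Transfer.fib (pw w R s) g y := by
  unfold Transfer.fib
  refine Finset.sum_congr rfl fun x _ => ?_
  by_cases h : pw w R s x y = 0
  · rw [h, zero_mul, zero_mul]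
  · rw [hug x (marg_ne_zero_of_pw hw0 hw1 h)]

/-- Fibre sum of a cluster function: `A_{H∘C}(ω₂) = w(ω₂) · Σ_x w(x) H(C x) 1[x avoids hit ω₂]`. [folklore] -/
theorem fib_cluster (H : Set (Sym2 V) → ℝ) (y : Set (Sym2 V)) :
    Transfer.fib (pw w R s) (fun x => H (rC Finset.univ s x)) y =
      weight w y * ∑ x, weight w x * (H (rC Finset.univ s x) * ind (rD Finset.univ s (hit R s y)) x) := by
  unfold Transfer.fib pw; rw [Finset.mul_sum]; exact Finset.sum_congr rfl fun x _ => by ring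

end Facts

section BHK

variable {w : Sym2 V → ℝ} {s : V}

/-- Total mass of the product weights is one (any real parameters). [folklore] -/
theorem sum_weight_eq_one {ι : Type*} [Fintype ι] (w : ι → ℝ) : ∑ ω : Set ι, weight w ω = 1 := by
  have h1 : ∑ ω : Set ι, weight w ω = ∑ t : Finset ι, weight w (↑t : Set ι) := by
    refine (Fintype.sum_equiv (Fintype.finsetEquivSet (α := ι)) (fun t => weight w (↑t : Set ι))
      (fun ω => weight w ω) (fun t => ?_)).symm
    simp [Fintype.finsetEquivSet]
  have h2 : ∀ t : Finset ι, weight w (↑t : Set ι) = (∏ e ∈ t, w e) * ∏ e ∈ univ \ t, (1 - w e) := by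
    intro t
    unfold weight
    rw [← Finset.prod_filter_mul_prod_filter_not Finset.univ (fun e => e ∈ t)]
    have ha : Finset.univ.filter (fun e => e ∈ t) = t := by ext e; simp
    have hb : Finset.univ.filter (fun e => ¬ e ∈ t) = Finset.univ \ t := by ext e; simp
    rw [ha, hb]
    congr 1
    · exact Finset.prod_congr rfl fun e he => by rw [if_pos (Finset.mem_coe.2 he)]
    · exact Finset.prod_congr rfl fun e he => by
        rw [if_neg (fun h => (Finset.mem_sdiff.1 he).2 (Finset.mem_coe.1 h))]
  rw [h1]
  simp_rw [h2]
  rw [← Finset.powerset_univ, ← Finset.prod_add]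
  simp

/-- van den Berg–Häggström–Kahn Thm 1.3 in finite-sum form, for monotone `F, G` of any sign:
`E[F 1_D] E[G 1_D] ≤ E[F G 1_D] P(D)`, `D = {s ↮ X}`. [cite: VandenbergHaggstromKahn2005, Thm. 1.3 (p. 6)] -/
theorem bhk_pa (hw0 : ∀ e, 0 ≤ w e) (hw1 : ∀ e, w e ≤ 1) (hm : ∑ ω, weight w ω = 1) (X : Set V)
    {F G : Set (Sym2 V) → ℝ} (hF : Monotone F) (hG : Monotone G) :
    (∑ ω, weight w ω * (F (rC Finset.univ s ω) * ind (rD Finset.univ s X) ω)) *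
      (∑ ω, weight w ω * (G (rC Finset.univ s ω) * ind (rD Finset.univ s X) ω)) ≤
    (∑ ω, weight w ω * (F (rC Finset.univ s ω) * G (rC Finset.univ s ω) * ind (rD Finset.univ s X) ω)) *
      ∑ ω, weight w ω * ind (rD Finset.univ s X) ω := by
  have hXU : X ⊆ ↑(Finset.univ : Finset V) := by simp
  have key := core w hw0 hw1 hm Finset.univ s (Finset.mem_univ s) X X hXU hXU
    (fun a => F a - F ∅) (fun a => G a - G ∅)
    (fun a b hab => sub_le_sub_right (hF hab) _) (fun a b hab => sub_le_sub_right (hG hab) _)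
    (fun a => sub_nonneg.2 (hF (Set.empty_subset a))) (fun a => sub_nonneg.2 (hG (Set.empty_subset a)))
  rw [Set.inter_self, Set.union_self] at key
  set P := ∑ ω, weight w ω * ind (rD Finset.univ s X) ω
  set A := ∑ ω, weight w ω * (F (rC Finset.univ s ω) * ind (rD Finset.univ s X) ω)
  set B := ∑ ω, weight w ω * (G (rC Finset.univ s ω) * ind (rD Finset.univ s X) ω)
  set Cfg := ∑ ω, weight w ω * (F (rC Finset.univ s ω) * G (rC Finset.univ s ω) * ind (rD Finset.univ s X) ω)
  have e1 : ∑ ω, weight w ω * ((F (rC Finset.univ s ω) - F ∅) * ind (rD Finset.univ s X) ω) =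
      A - F ∅ * P := by
    simp only [A, P, Finset.mul_sum, ← Finset.sum_sub_distrib]
    exact Finset.sum_congr rfl fun ω _ => by ring
  have e2 : ∑ ω, weight w ω * ((G (rC Finset.univ s ω) - G ∅) * ind (rD Finset.univ s X) ω) =
      B - G ∅ * P := by
    simp only [B, P, Finset.mul_sum, ← Finset.sum_sub_distrib]
    exact Finset.sum_congr rfl fun ω _ => by ring
  have e3 : ∑ ω, weight w ω * ((F (rC Finset.univ s ω) - F ∅) * (G (rC Finset.univ s ω) - G ∅) *
      ind (rD Finset.univ s X) ω) = Cfg - G ∅ * A - F ∅ * B + F ∅ * G ∅ * P := by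
    simp only [A, B, Cfg, P, Finset.mul_sum, ← Finset.sum_sub_distrib, ← Finset.sum_add_distrib]
    exact Finset.sum_congr rfl fun ω _ => by ring
  rw [e1, e2, e3] at key
  nlinarith [key]

/-- Monotonicity of `E[F | s ↮ X]` in `X` (BHK Thm 1.1 with `G = 1`): for `X ⊆ X'` and `F` monotone,
`E[F 1_{D_X'}] P(D_X) ≤ E[F 1_{D_X}] P(D_X')`. [cite: VandenbergHaggstromKahn2005, Thm. 1.1 (pp. 3–5)] -/
theorem bhk_mono (hw0 : ∀ e, 0 ≤ w e) (hw1 : ∀ e, w e ≤ 1) (hm : ∑ ω, weight w ω = 1) {X X' : Set V}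
    (hXX : X ⊆ X') {F : Set (Sym2 V) → ℝ} (hF : Monotone F) :
    (∑ ω, weight w ω * (F (rC Finset.univ s ω) * ind (rD Finset.univ s X') ω)) *
      (∑ ω, weight w ω * ind (rD Finset.univ s X) ω) ≤
    (∑ ω, weight w ω * (F (rC Finset.univ s ω) * ind (rD Finset.univ s X) ω)) *
      ∑ ω, weight w ω * ind (rD Finset.univ s X') ω := by
  have hXU : X ⊆ ↑(Finset.univ : Finset V) := by simp
  have hXU' : X' ⊆ ↑(Finset.univ : Finset V) := by simp
  have key := core w hw0 hw1 hm Finset.univ s (Finset.mem_univ s) X' X hXU' hXU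
    (fun a => F a - F ∅) (fun _ => (1 : ℝ))
    (fun a b hab => sub_le_sub_right (hF hab) _) (fun _ _ _ => le_rfl)
    (fun a => sub_nonneg.2 (hF (Set.empty_subset a))) (fun _ => zero_le_one)
  rw [Set.inter_eq_right.2 hXX, Set.union_eq_left.2 hXX] at key
  set P := ∑ ω, weight w ω * ind (rD Finset.univ s X) ω
  set P' := ∑ ω, weight w ω * ind (rD Finset.univ s X') ω
  set A := ∑ ω, weight w ω * (F (rC Finset.univ s ω) * ind (rD Finset.univ s X) ω)
  set A' := ∑ ω, weight w ω * (F (rC Finset.univ s ω) * ind (rD Finset.univ s X') ω)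
  have e1 : ∑ ω, weight w ω * ((F (rC Finset.univ s ω) - F ∅) * ind (rD Finset.univ s X') ω) =
      A' - F ∅ * P' := by
    simp only [A', P', Finset.mul_sum, ← Finset.sum_sub_distrib]
    exact Finset.sum_congr rfl fun ω _ => by ring
  have e2 : ∑ ω, weight w ω * ((1 : ℝ) * ind (rD Finset.univ s X) ω) = P := by
    simp only [P, one_mul]
  have e3 : ∑ ω, weight w ω * ((F (rC Finset.univ s ω) - F ∅) * 1 * ind (rD Finset.univ s X) ω) =
      A - F ∅ * P := by
    simp only [A, P, Finset.mul_sum, ← Finset.sum_sub_distrib]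
    exact Finset.sum_congr rfl fun ω _ => by ring
  rw [e1, e2, e3] at key
  nlinarith [key]

/-- `P(s ↮ X) ≤ 1`. [folklore] -/
theorem prob_le_one (hw0 : ∀ e, 0 ≤ w e) (hw1 : ∀ e, w e ≤ 1) (hm : ∑ ω, weight w ω = 1) (X : Set V) :
    ∑ ω, weight w ω * ind (rD Finset.univ s X) ω ≤ 1 := by
  calc ∑ ω, weight w ω * ind (rD Finset.univ s X) ω ≤ ∑ ω, weight w ω * 1 :=
        Finset.sum_le_sum fun ω _ => mul_le_mul_of_nonneg_left (ind_le_one _ _) (weight_nonneg hw0 hw1 ω)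
    _ = 1 := by simp [hm]

/-- `P(s ↮ X) ≥ w(∅) > 0` for `X ⊆ R ∌ s` when no pair is open almost surely. [folklore] -/
theorem prob_pos (hw0 : ∀ e, 0 ≤ w e) (hw1 : ∀ e, w e < 1) {R : Set V} (hs : s ∉ R) {X : Set V}
    (hX : X ⊆ R) : 0 < ∑ ω, weight w ω * ind (rD Finset.univ s X) ω := by
  have hw1' : ∀ e, w e ≤ 1 := fun e => (hw1 e).le
  have hempty : (∅ : Set (Sym2 V)) ∈ rD Finset.univ s X := by
    intro x hx hsx
    have hne : x ≠ s := fun h => hs (h ▸ hX hx)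
    rcases (reachable_iff_exists_mem_openEdgeCluster _ s x).1 hsx with h | ⟨e, he, -⟩
    · exact hne h
    · exact (openEdgeCluster_subset _ s he).1
  have hwpos : 0 < weight w ∅ := by
    unfold weight
    exact Finset.prod_pos fun e _ => by simp only [Set.mem_empty_iff_false, if_false]; linarith [hw1 e]
  calc 0 < weight w ∅ * ind (rD Finset.univ s X) ∅ := by rw [ind_of_mem hempty, mul_one]; exact hwpos
    _ ≤ ∑ ω, weight w ω * ind (rD Finset.univ s X) ω :=
        Finset.single_le_sum (f := fun ω => weight w ω * ind (rD Finset.univ s X) ω)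
          (fun ω _ => mul_nonneg (weight_nonneg hw0 hw1' ω) (ind_nonneg _ _)) (Finset.mem_univ _)

end BHK

section Main

variable {w : Sym2 V → ℝ} {R : Set V} {s : V}

/-- **The hypotheses of the alternating-transfer lemma hold for two independent percolation clusters coupled by
bicluster avoidance** (fibre PA and alternation = BHK Thm 1.3 / 1.1; Doeblin witness = the law conditioned on
`s ↮ R`). [cite: VandenbergHaggstromKahn2005, Thm. 1.3 (p. 6)] -/
theorem hyp (hw0 : ∀ e, 0 ≤ w e) (hw1 : ∀ e, w e < 1) (hs : s ∉ R) :
    Transfer.Hyp (pw w R s) (UpC w R s) := by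
  have hw1' : ∀ e, w e ≤ 1 := fun e => (hw1 e).le
  have hm : ∑ ω, weight w ω = 1 := sum_weight_eq_one w
  refine ⟨fun x y => pw_symm x y, fun x y => pw_nonneg hw0 hw1' x y, ?_, ?_, ?_⟩
  · -- fibre PA
    rintro y u v ⟨F, hF, huF⟩ ⟨G, hG, hvG⟩
    rw [fib_congr hw0 hw1' huF y, fib_congr hw0 hw1' hvG y,
      fib_congr hw0 hw1' (u := fun x => u x * v x) (g := fun x => F (rC Finset.univ s x) * G (rC Finset.univ s x))
        (fun x hx => by simp only [huF x hx, hvG x hx]) y,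
      fib_cluster F y, fib_cluster G y, fib_cluster (fun c => F c * G c) y, marg_eq y]
    have key := bhk_pa hw0 hw1' hm (hit R s y) hF hG (s := s)
    have hwy : 0 ≤ weight w y * weight w y := mul_nonneg (weight_nonneg hw0 hw1' y) (weight_nonneg hw0 hw1' y)
    nlinarith [key, hwy]
  · -- alternation
    rintro u ⟨F, hF, huF⟩
    refine ⟨fun c => -(∑ x, weight w x * (F (rC Finset.univ s x) * ind (rD Finset.univ s (hitC R c)) x)) /
        ∑ x, weight w x * ind (rD Finset.univ s (hitC R c)) x, ?_, ?_⟩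
    · intro c c' hcc
      have hXX : hitC R c ⊆ hitC R c' := hitC_mono R hcc
      have hP : 0 < ∑ x, weight w x * ind (rD Finset.univ s (hitC R c)) x :=
        prob_pos hw0 hw1 hs (fun _ h => h.1)
      have hP' : 0 < ∑ x, weight w x * ind (rD Finset.univ s (hitC R c')) x :=
        prob_pos hw0 hw1 hs (fun _ h => h.1)
      have key := bhk_mono hw0 hw1' hm hXX hF (s := s)
      dsimp only
      rw [neg_div, neg_div, neg_le_neg_iff, div_le_div_iff₀ hP' hP]
      linarith [key]
    · intro y hy
      have hwy : weight w y ≠ 0 := by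
        intro h0; apply hy; rw [marg_eq y, h0, zero_mul]
      simp only [Transfer.strans, Transfer.transfer]
      rw [fib_congr hw0 hw1' huF y, fib_cluster F y, marg_eq y, hit_eq_hitC hs y,
        mul_div_mul_left _ _ hwy, neg_div]
  · -- Doeblin
    set ε := ∑ x, weight w x * ind (rD Finset.univ s R) x with hε
    have hεpos : 0 < ε := prob_pos hw0 hw1 hs le_rfl
    refine ⟨ε, hεpos, fun x => weight w x * ind (rD Finset.univ s R) x / ε, fun x =>
      div_nonneg (mul_nonneg (weight_nonneg hw0 hw1' x) (ind_nonneg _ _)) hεpos.le, ?_, ?_⟩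
    · rw [← Finset.sum_div, div_self hεpos.ne']
    · intro x y
      rw [mul_div_cancel₀ _ hεpos.ne', marg_eq y]
      unfold pw
      have h1 : ∑ x, weight w x * ind (rD Finset.univ s (hit R s y)) x ≤ 1 := prob_le_one hw0 hw1' hm _
      have h2 : ind (rD Finset.univ s R) x ≤ ind (rD Finset.univ s (hit R s y)) x :=
        ind_mono (rD_antitone (hit_subset R s y)) x
      have hwx := weight_nonneg hw0 hw1' x
      have hwy := weight_nonneg hw0 hw1' y
      have hi := ind_nonneg (rD Finset.univ s R) x
      calc weight w x * ind (rD Finset.univ s R) x *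
            (weight w y * ∑ x, weight w x * ind (rD Finset.univ s (hit R s y)) x)
          ≤ weight w x * ind (rD Finset.univ s R) x * (weight w y * 1) :=
            mul_le_mul_of_nonneg_left (mul_le_mul_of_nonneg_left h1 hwy) (mul_nonneg hwx hi)
        _ ≤ weight w x * weight w y * ind (rD Finset.univ s (hit R s y)) x := by
            rw [mul_one]; nlinarith [mul_nonneg hwx hwy]

/-- **THEOREM IC (independent-copies BIC), finite-sum form.**  Bond percolation with pair probabilities
`w e ∈ [0, 1)` on a finite vertex type (`w e = 0` off the graph); `C = rC univ s` the open edge cluster of `s`;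
two INDEPENDENT configurations `ω₁, ω₂` weighted by `1[no r ∈ R is joined to s in both]`.  For all monotone
`F, G`:  `0 ≤ Σ_{ω₁,ω₂} w(ω₁) w(ω₂) 1[W₁ ∩ W₂ ∩ R = ∅] (F(C₁) − F(C₂)) (G(C₁) − G(C₂))` — "same ≥ cross" for the
bicluster-avoidance kernel of CONJECTURE BIC with the antithetic copy replaced by an independent one.
[cite: VandenbergHaggstromKahn2005, Thm. 1.3 (p. 6)] -/
theorem indep_bic_nonneg (hw0 : ∀ e, 0 ≤ w e) (hw1 : ∀ e, w e < 1) (hs : s ∉ R) {F G : Set (Sym2 V) → ℝ} (hF : Monotone F) (hG : Monotone G) :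
    0 ≤ ∑ ω₁, ∑ ω₂, pw w R s ω₁ ω₂ *
      ((F (rC Finset.univ s ω₁) - F (rC Finset.univ s ω₂)) *
        (G (rC Finset.univ s ω₁) - G (rC Finset.univ s ω₂))) :=
  Transfer.pair_form_nonneg (hyp hw0 hw1 hs) ⟨F, hF, fun _ _ => rfl⟩ ⟨G, hG, fun _ _ => rfl⟩

/-- **THEOREM IC (a): the one-copy marginal is positively associated on increasing cluster functions**:
`(Σ ν F(C))(Σ ν G(C)) ≤ (Σ ν) Σ ν F(C) G(C)` with `ν(ω) = w(ω) P(C' avoids R ∩ W(ω))`.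
[cite: VandenbergHaggstromKahn2005, Thm. 1.3 (p. 6)] -/
theorem marginal_pa (hw0 : ∀ e, 0 ≤ w e) (hw1 : ∀ e, w e < 1) (hs : s ∉ R) {F G : Set (Sym2 V) → ℝ} (hF : Monotone F) (hG : Monotone G) :
    (∑ ω, Transfer.marg (pw w R s) ω * F (rC Finset.univ s ω)) *
      (∑ ω, Transfer.marg (pw w R s) ω * G (rC Finset.univ s ω)) ≤
    Transfer.mass (pw w R s) *
      ∑ ω, Transfer.marg (pw w R s) ω * (F (rC Finset.univ s ω) * G (rC Finset.univ s ω)) :=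
  Transfer.marginal_pa (hyp hw0 hw1 hs) ⟨F, hF, fun _ _ => rfl⟩ ⟨G, hG, fun _ _ => rfl⟩

/-- **THEOREM IC (b): the two copies are negatively correlated on increasing cluster functions**:
`(Σ ν) Σ_{ω₁,ω₂} π(ω₁,ω₂) F(C₁) G(C₂) ≤ (Σ ν F(C))(Σ ν G(C))`. [cite: VandenbergHaggstromKahn2005, Thm. 1.3 (p. 6)] -/
theorem cross_le (hw0 : ∀ e, 0 ≤ w e) (hw1 : ∀ e, w e < 1) (hs : s ∉ R) {F G : Set (Sym2 V) → ℝ} (hF : Monotone F) (hG : Monotone G) :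
    Transfer.mass (pw w R s) *
        ∑ ω, F (rC Finset.univ s ω) * Transfer.fib (pw w R s) (fun x => G (rC Finset.univ s x)) ω ≤
    (∑ ω, Transfer.marg (pw w R s) ω * F (rC Finset.univ s ω)) *
      ∑ ω, Transfer.marg (pw w R s) ω * G (rC Finset.univ s ω) :=
  Transfer.cross_le (hyp hw0 hw1 hs) ⟨F, hF, fun _ _ => rfl⟩ ⟨G, hG, fun _ _ => rfl⟩

end Main

end IndepCopies

end Antithetic
end Summit.CriticalPhenomena.PercolationContinuityZ3.Theorems
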